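import Mathlib.Combinatorics.SimpleGraph.Coloring.Vertex
import Literature.Computability.MetaComplexity.SumOfSquares
import HarnessLib

/-!
# Linear-degree Sum-of-Squares lower bounds for 3-colourability

Trunk Literature/Computability/MetaComplexity; cite item `wi-10420` (route PneNP/DescentTower,
crux `JointSublinearFooling`, its SOS part), in the pseudoexpectation vocabulary of
`SumOfSquares.lean` (`IsPseudoexpectation`, `SatisfiesIdentity`, `boolAxiom`).

* `ThreeColPseudoexpectation n G d E`: `E` is a degree-`d` pseudoexpectation for the standard
  polynomial encoding of "the graph `G` on `Fin n` is properly 3-coloured" in the `0/1`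
  indeterminates `x_{v,a} = X (3 v + a)` (`v : Fin n`, `a : Fin 3`): Booleanity `x² = x` (for
  every indeterminate of `MvPolynomial ℕ ℝ`), `∑_a x_{v,a} = 1`, `x_{v,a} x_{v,b} = 0` (`a ≠ b`),
  and `x_{u,a} x_{v,a} = 0` on edges. This is the encoding of `k`-COLOR displayed in
  Atserias–Ochremiak §8.1 (= Lauria–Nordström 2017) together with the Booleanity axioms that are
  part of every SOS system there (§2); the `0/1` program of CSP(`K₃`) has the same variables.
* `SOSFailsToRefuteThreeCol d G`: such an `E` exists ("degree-`d` SOS does not refute the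
  3-colourability of `G`").
* NAMED FACT `SOSThreeColLinearLowerBound`: there is `c > 0` such that for all large `n` some
  NON-3-colourable graph on `n` vertices is not refuted by degree-`⌊c n⌋` SOS.
* `sos_threeCol_sublinear`: the `o(n)` corollary, in the literal shape of the SOS clause of
  `Summit.PneNP.PneNP.Theses.DescentTower.JointSublinearFooling` (every sublinear degree
  `2 k(n)`, `k(n)/n → 0`, is eventually fooled by a non-3-colourable graph).
* Sanity (`threeColPseudoexpectation_of_coloring`): a 3-colourable graph is fooled in EVERY
  degree (evaluation at the `0/1` point of a colouring), so the definitions are not vacuous in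
  the wrong direction; monotonicity in the degree (`….of_le`).

Sources, and what exactly they print. Thapper–Živný (ACM ToCT 2018 / LICS 2017), §3.3 "Main
Results", Theorem `thm:main` (Thm. 2 in the numbering of the held arXiv:1612.01147 text): for a
general-valued constraint language `Γ` of finite size, VCSP(`Γ`) *requires linear levels of the
Lasserre SDP hierarchy* iff `supp(Γ)` violates the bounded width condition (iff `Γ` can simulate
linear equations); Def. `def:linear` (Def. 12): "requires linear levels" means there is
`0 < c < 1` such that for all sufficiently large `n` there is an `n`-variable GAP instance `I_n`
for `Las(⌊c n⌋)` (Def. 11: `sdpopt(I, k) < vcspopt(I)`), which for a crisp (`{0,∞}`-valued)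
language is an UNSATISFIABLE instance whose level-`⌊cn⌋` Lasserre relaxation (their Fig. 2,
Tulsiani's formulation) is FEASIBLE. The template `K₃ = ({1,2,3}, ≠)` is crisp, a core and of
unbounded width (Atserias–Ochremiak §8.1: "well known, see e.g. Feder–Vardi 1998"), i.e. its
support violates the BWC (Thapper–Živný Thm. 1, Barto–Kozik); an `n`-variable instance of
CSP(`K₃`) is a (multi/di)graph on `n` vertices, loops being excluded by the feasibility of the
relaxation. So: `∃ c > 0`, for all large `n`, a non-3-colourable graph on `n` vertices with a
feasible `Las(⌊cn⌋)` solution. A feasible `Las(t)` solution (vectors `λ_X(σ)` for all `|X| ≤ t`,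
`σ : X → D`) yields a degree-`t` pseudoexpectation of the `0/1` encoding by
`E(M) = ∑_{σ : S → D, σ(M) = 1} ‖λ_S(σ)‖²` for a monomial `M` mentioning the vertex set `S`
(`|S| ≤ deg M ≤ t`): positive semidefinite on squares of degree `≤ t/2` because the moment matrix
is the Gram matrix of the vectors `∑_{σ(M)=1} λ_{S_M}(σ)` (Thapper–Živný Lemma 3 (L7) with
(las:cons), (las:split)); this is literally the functional `E` of Atserias–Ochremiak §6.4, where the
Booleanity, `∑_a x_{v,a} = 1`, `x_{v,a} x_{v,b} = 0` and constraint identities are checked. Hence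
the fact below, with the `c` of Def. 12. The same statement in REFUTATION form — for `k`-colouring,
any `k ≥ 3`, graphs `G_n` with `Θ(n)` vertices and `Θ(n)` edges — is Atserias–Ochremiak
Cor. `cor:coloring` (Cor. 5 of the held arXiv:1711.07320 text), item 4: "every SOS refutation of
`E(G_n)` has degree at least `ε n`" for every local encoding scheme `E`, proved from Chan's Lasserre
lower bound for `3LIN(G)` (their Thm. 17 = Chan 2016 Thm. G.8, via the pseudoexpectation of §6.4)
and the closure of SOS degree under pp-interpretations (their Thm. 7); the last paragraph of their
§8 records that Grigoriev 2001 / Schoenebeck 2008 in place of Chan give explicit hard 3-colouring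
instances for Lasserre/SOS.

What is NOT the source. Dawar–Wang (LICS 2017) Thm. 7 / Cor. 8 ("for any VCSP(D, Γ) either every
instance `I` is solved by BLP(I), or `L_Γ(n) ∈ Ω(n)`", via Lemma 9 `L_Γ ∈ Ω(ν_Γ)` — counting
width — and Lemma 10) is stated and proved for FINITE-VALUED languages only; the paper says so
(§II-B, last paragraph: "our proof technique is specifically suited for the finite-valued variant
as this guarantees that the resulting SDPs in the Lasserre hierarchy are non-empty"). It covers
MAX-3-COL = MAXCSP(`K₃`) (exact optimisation needs `Ω(n)` Lasserre levels) but not the crisp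
decision problem formalised here, which is Thapper–Živný's general-valued theorem (their Cor. 2
identifies Dawar–Wang's result as the finite-valued case). We therefore cite Thapper–Živný and
Atserias–Ochremiak on the declarations and Dawar–Wang only in this paragraph.

Dischargeability (not attempted in this file). The tree PROVES the Grigoriev–Schoenebeck theorem
`sosFailsToRefute_of_isBoundaryExpander` (`XorPseudoexpectation.lean`) and the first-moment /
expansion counts for random 3-CNFs (`RandomCNFFirstMoment.lean`); with the standard 3-SAT → 3-COL
gadget interpretation (Atserias–Ochremiak §8.2), pushing the pseudoexpectation forward along the
substitution `x_{g,a} ↦` indicator polynomial of the local assignments of one clause, and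
isolated-vertex padding, `SOSThreeColLinearLowerBound_holds` is within reach of the tree.

## References

* J. Thapper, S. Živný, *The limits of SDP relaxations for general-valued CSPs*, ACM ToCT 10(3)
  (2018) / LICS 2017, arXiv:1612.01147: §3.2 (Lasserre relaxation, Def. 11), Def. 12, Thm. 2
  (`thm:main`), Cor. 1–2, Thm. 3 (Chan), Lemma 3. [ThapperZivny2018]
* A. Atserias, J. Ochremiak, *Proof complexity meets algebra*, ACM ToCL 20(1) (2019) / ICALP 2017,
  arXiv:1711.07320: §6 (definition of "SOS refutations of degree `d(n)`"), §6.4 (Thm. 17 and the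
  pseudoexpectation `E`), §8.1 Cor. 5 (`cor:coloring`) and the encoding displayed after it, §8.2.
  [AtseriasOchremiak2018]
* A. Dawar, P. Wang, *Definability of semidefinite programming and Lasserre lower bounds for
  CSPs*, LICS 2017: Thm. 6, Thm. 7, Cor. 8, Lemmas 9–10, §II-B. [DawarWang2017]
* S. O. Chan, *Approximation resistance from pairwise-independent subgroups*, J. ACM 63 (2016),
  Thm. G.8; D. Grigoriev, TCS 259 (2001); G. Schoenebeck, FOCS 2008 (the `3LIN` base case).
* P. K. Kothari, R. Mori, R. O'Donnell, D. Witmer, arXiv:1701.04521, Defs. 2.7–2.8, §2.3 (the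
  pseudoexpectation vocabulary of `SumOfSquares.lean`; SOS duality on the hypercube).
-/

noncomputable section

open Filter MvPolynomial

namespace Literature.Computability.MetaComplexity

/-! ### The 3-colouring polynomial system and its pseudoexpectations -/

/-- `E` is a **degree-`d` pseudoexpectation for the 3-colouring system of `G`** (a graph on
`Fin n`; indeterminates `x_{v,a} = X (3 v + a)`, `v : Fin n`, `a : Fin 3`): a degree-`d`
pseudoexpectation (`E 1 = 1`, `E p² ≥ 0` for `2 deg p ≤ d`) satisfying in degree `d` the identities
`x_i² - x_i = 0` (all `i : ℕ`), `1 - ∑_a x_{v,a} = 0` (`v : Fin n`), `x_{v,a} x_{v,b} = 0` (`a ≠ b`)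
and `x_{u,a} x_{v,a} = 0` (`G.Adj u v`, `a : Fin 3`). (Atserias–Ochremiak 2019, §8.1: the displayed
encoding of `k`-COLOR, with the Booleanity axioms of §2 and the functional `E` of §6.4;
Kothari–Mori–O'Donnell–Witmer 2017, Defs. 2.7–2.8.) [cite: AtseriasOchremiak2018, §8.1 and §6.4] -/
def ThreeColPseudoexpectation (n : ℕ) (G : SimpleGraph (Fin n)) (d : ℕ)
    (E : MvPolynomial ℕ ℝ →ₗ[ℝ] ℝ) : Prop :=
  IsPseudoexpectation d E ∧
    (∀ i : ℕ, SatisfiesIdentity d E (boolAxiom i)) ∧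
    (∀ v : Fin n, SatisfiesIdentity d E (1 - ∑ a : Fin 3, X (3 * v.val + a.val))) ∧
    (∀ v : Fin n, ∀ a b : Fin 3, a ≠ b →
      SatisfiesIdentity d E (X (3 * v.val + a.val) * X (3 * v.val + b.val))) ∧
    (∀ u v : Fin n, G.Adj u v → ∀ a : Fin 3,
      SatisfiesIdentity d E (X (3 * u.val + a.val) * X (3 * v.val + a.val)))

/-- **Degree-`d` SOS fails to refute the 3-colourability of `G`**: some degree-`d`
pseudoexpectation for its 3-colouring system exists (by SOS duality on the hypercube: there is no
degree-`d` SOS refutation of the system; for an unsatisfiable instance this is a GAP instance in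
the sense of Thapper–Živný 2018, Def. 11). (Atserias–Ochremiak 2019, §6 and §8.1.)
[cite: AtseriasOchremiak2018, §6.4 and §8.1] -/
def SOSFailsToRefuteThreeCol (d : ℕ) {n : ℕ} (G : SimpleGraph (Fin n)) : Prop :=
  ∃ E : MvPolynomial ℕ ℝ →ₗ[ℝ] ℝ, ThreeColPseudoexpectation n G d E

/-! ### The named fact -/

/-- NAMED FACT (**linear-level Lasserre / SOS lower bound for 3-colourability**: Thapper–Živný
2018, Thm. `thm:main` with Def. 12, for the crisp template `K₃` of unbounded width; equivalently
Atserias–Ochremiak 2019, Cor. `cor:coloring` item 4, in primal form): there is a constant `c > 0`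
such that for all sufficiently large `n` there is a graph on `n` vertices that is NOT 3-colourable
and yet degree-`⌊c n⌋` Sum-of-Squares fails to refute its 3-colourability, i.e. its 3-colouring
system admits a degree-`⌊c n⌋` pseudoexpectation. (Printed: "there is `0 < c < 1` such that for
sufficiently large `n` there is an `n`-variable gap instance `I_n` of VCSP(`Γ`) for `Las(⌊cn⌋)`",
for every `Γ` of finite size whose support violates the bounded width condition; a feasible `Las(t)`
solution gives a degree-`t` pseudoexpectation by Atserias–Ochremiak §6.4 — see the module
docstring; the bound `c < 1` is dropped.) Users take `(h : SOSThreeColLinearLowerBound)`; the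
`o(n)` form consumed by route DescentTower is `sos_threeCol_sublinear`. (Thapper–Živný 2018, §3.3
Thm. 2 = `thm:main` and Def. 12, arXiv numbering; Atserias–Ochremiak 2019, §8.1 Cor. 5 =
`cor:coloring` item 4 and §6.4; base case Chan 2016 Thm. G.8 / Grigoriev 2001 / Schoenebeck 2008.)
[cite: ThapperZivny2018, §3.3 Theorem thm:main with Definition 12] -/
def SOSThreeColLinearLowerBound : Prop :=
  ∃ c : ℝ, 0 < c ∧ ∀ᶠ n : ℕ in atTop, ∃ G : SimpleGraph (Fin n),
    ¬ G.Colorable 3 ∧ SOSFailsToRefuteThreeCol ⌊c * n⌋₊ G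

/-! ### Monotonicity in the degree -/

/-- A degree-`d` pseudoexpectation is a degree-`d'` one for `d' ≤ d`.
(Kothari–Mori–O'Donnell–Witmer 2017, §2.3.) [folklore] -/
theorem IsPseudoexpectation.of_le {d d' : ℕ} {E : MvPolynomial ℕ ℝ →ₗ[ℝ] ℝ}
    (h : IsPseudoexpectation d E) (hd : d' ≤ d) : IsPseudoexpectation d' E :=
  ⟨h.1, fun p hp => h.2 p (hp.trans hd)⟩

/-- An identity satisfied in degree `d` is satisfied in every degree `d' ≤ d`.
(Kothari–Mori–O'Donnell–Witmer 2017, Def. 2.8.) [folklore] -/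
theorem SatisfiesIdentity.of_le {d d' : ℕ} {E : MvPolynomial ℕ ℝ →ₗ[ℝ] ℝ} {q : MvPolynomial ℕ ℝ}
    (h : SatisfiesIdentity d E q) (hd : d' ≤ d) : SatisfiesIdentity d' E q :=
  fun r hr => h r (hr.trans hd)

/-- A degree-`d` pseudoexpectation for the 3-colouring system is a degree-`d'` one, `d' ≤ d`.
[folklore] -/
theorem ThreeColPseudoexpectation.of_le {n : ℕ} {G : SimpleGraph (Fin n)} {d d' : ℕ}
    {E : MvPolynomial ℕ ℝ →ₗ[ℝ] ℝ} (h : ThreeColPseudoexpectation n G d E) (hd : d' ≤ d) :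
    ThreeColPseudoexpectation n G d' E := by
  obtain ⟨hE, hB, hS, hD, hA⟩ := h
  exact ⟨hE.of_le hd, fun i => (hB i).of_le hd, fun v => (hS v).of_le hd,
    fun v a b hab => (hD v a b hab).of_le hd, fun u v huv a => (hA u v huv a).of_le hd⟩

/-- If degree `d` fails to refute 3-colourability then so does every degree `d' ≤ d`.
[folklore] -/
theorem SOSFailsToRefuteThreeCol.of_le {n : ℕ} {G : SimpleGraph (Fin n)} {d d' : ℕ}
    (h : SOSFailsToRefuteThreeCol d G) (hd : d' ≤ d) : SOSFailsToRefuteThreeCol d' G := by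
  obtain ⟨E, hE⟩ := h
  exact ⟨E, hE.of_le hd⟩

/-! ### Soundness: a 3-colourable graph is never refuted -/

/-- The `0/1` point of a 3-colouring `C`: the indeterminate `X (3 v + a)` is set to `1` iff
`C v = a`, and every indeterminate off the board (`i / 3 ≥ n`) to `0`. [folklore] -/
def colPoint {n : ℕ} {G : SimpleGraph (Fin n)} (C : G.Coloring (Fin 3)) (i : ℕ) : ℝ :=
  if h : i / 3 < n then (if (C ⟨i / 3, h⟩).val = i % 3 then 1 else 0) else 0

/-- `colPoint C (3 v + a) = [C v = a]`. [folklore] -/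
theorem colPoint_apply {n : ℕ} {G : SimpleGraph (Fin n)} (C : G.Coloring (Fin 3)) (v : Fin n)
    (a : Fin 3) : colPoint C (3 * v.val + a.val) = if C v = a then 1 else 0 := by
  have h1 : (3 * v.val + a.val) / 3 = v.val := by
    rw [Nat.mul_add_div (by norm_num), Nat.div_eq_of_lt a.isLt, add_zero]
  have h2 : (3 * v.val + a.val) % 3 = a.val := by
    rw [Nat.mul_add_mod, Nat.mod_eq_of_lt a.isLt]
  unfold colPoint
  have hlt : (3 * v.val + a.val) / 3 < n := by rw [h1]; exact v.isLt
  rw [dif_pos hlt, h2]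
  have hv : (⟨(3 * v.val + a.val) / 3, hlt⟩ : Fin n) = v := Fin.ext h1
  rw [hv]
  by_cases hC : C v = a
  · rw [if_pos hC, if_pos (congrArg Fin.val hC)]
  · rw [if_neg hC, if_neg (fun h => hC (Fin.ext h))]

/-- The coordinates of `colPoint C` are idempotent (`0` or `1`). [folklore] -/
theorem colPoint_mul_self {n : ℕ} {G : SimpleGraph (Fin n)} (C : G.Coloring (Fin 3)) (i : ℕ) :
    colPoint C i * colPoint C i = colPoint C i := by
  unfold colPoint
  split_ifs <;> norm_num

/-- **Soundness.** Evaluation at the `0/1` point of a proper 3-colouring is a pseudoexpectation of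
EVERY degree for the 3-colouring system (a genuine expectation is a pseudoexpectation): so SOS of
no degree refutes a 3-colourable graph, and `SOSThreeColLinearLowerBound` is not vacuous in the
wrong direction. (Kothari–Mori–O'Donnell–Witmer 2017, §2.3: "any probability distribution on
solutions yields a valid degree-`d` pseudoexpectation".) [folklore] -/
theorem threeColPseudoexpectation_of_coloring {n : ℕ} {G : SimpleGraph (Fin n)}
    (C : G.Coloring (Fin 3)) (d : ℕ) :
    ThreeColPseudoexpectation n G d (MvPolynomial.aeval (colPoint C)).toLinearMap := by
  refine ⟨⟨by simp, fun p _ => ?_⟩, fun i r _ => ?_, fun v r _ => ?_, fun v a b hab r _ => ?_,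
    fun u v huv a r _ => ?_⟩
  · simp only [AlgHom.toLinearMap_apply, map_mul]
    exact mul_self_nonneg _
  · simp only [AlgHom.toLinearMap_apply, map_mul, boolAxiom, map_sub, map_pow, aeval_X]
    rw [sq, colPoint_mul_self, sub_self, zero_mul]
  · simp only [AlgHom.toLinearMap_apply, map_mul, map_sub, map_one, map_sum, aeval_X,
      colPoint_apply]
    rw [Finset.sum_ite_eq, if_pos (Finset.mem_univ _), sub_self, zero_mul]
  · simp only [AlgHom.toLinearMap_apply, map_mul, aeval_X, colPoint_apply]
    by_cases ha : C v = a
    · rw [if_neg (fun hb : C v = b => hab (ha.symm.trans hb))]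
      ring
    · rw [if_neg ha]
      ring
  · simp only [AlgHom.toLinearMap_apply, map_mul, aeval_X, colPoint_apply]
    have hne : C u ≠ C v := C.valid huv
    by_cases ha : C u = a
    · rw [if_neg (fun hb : C v = a => hne (ha.trans hb.symm))]
      ring
    · rw [if_neg ha]
      ring

/-- Hence a 3-colourable graph is fooled in every degree. [folklore] -/
theorem sosFailsToRefuteThreeCol_of_colorable {n : ℕ} {G : SimpleGraph (Fin n)}
    (h : G.Colorable 3) (d : ℕ) : SOSFailsToRefuteThreeCol d G := by
  obtain ⟨C⟩ := h
  exact ⟨_, threeColPseudoexpectation_of_coloring C d⟩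

/-! ### The sublinear form consumed by route DescentTower -/

/-- **Every sublinear SOS degree is fooled by 3-colourability** (corollary of
`SOSThreeColLinearLowerBound`, in the literal shape of the SOS clause of crux
`JointSublinearFooling` of route PneNP/DescentTower): for every `k : ℕ → ℕ` with `k(n)/n → 0`,
for all large `n` some non-3-colourable graph on `n` vertices carries a degree-`2k(n)`
pseudoexpectation satisfying Booleanity, `∑_a x_{v,a} = 1` and the edge identities. Proof:
eventually `2 k(n) ≤ ⌊c n⌋` and pseudoexpectations restrict to lower degree. (Thapper–Živný 2018,
Thm. 2 with Def. 12; Atserias–Ochremiak 2019, Cor. 5 (4): "no SOS refutations of sublinear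
degree".) [folklore] -/
theorem sos_threeCol_sublinear (h : SOSThreeColLinearLowerBound) (k : ℕ → ℕ)
    (hk : Filter.Tendsto (fun n : ℕ => (k n : ℝ) / n) Filter.atTop (nhds 0)) :
    ∀ᶠ n : ℕ in Filter.atTop, ∃ G : SimpleGraph (Fin n), ¬ G.Colorable 3 ∧
      ∃ E : MvPolynomial ℕ ℝ →ₗ[ℝ] ℝ, IsPseudoexpectation (2 * (k n)) E ∧
        (∀ i : ℕ, SatisfiesIdentity (2 * (k n)) E (boolAxiom i)) ∧
        (∀ v : Fin n, SatisfiesIdentity (2 * (k n)) E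
          (1 - ∑ c : Fin 3, MvPolynomial.X (3 * v.val + c.val))) ∧
        (∀ u v : Fin n, G.Adj u v → ∀ c : Fin 3, SatisfiesIdentity (2 * (k n)) E
          (MvPolynomial.X (3 * u.val + c.val) * MvPolynomial.X (3 * v.val + c.val))) := by
  obtain ⟨c, hc, hev⟩ := h
  have h1 : ∀ᶠ n : ℕ in atTop, (k n : ℝ) / n < c / 2 := hk.eventually_lt_const (half_pos hc)
  filter_upwards [hev, h1, eventually_ge_atTop 1] with n hn hlt hn1
  obtain ⟨G, hG, E, hE, hB, hS, -, hA⟩ := hn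
  have hle : 2 * k n ≤ ⌊c * n⌋₊ := by
    have hnpos : (0 : ℝ) < n := by exact_mod_cast hn1
    rw [div_lt_iff₀ hnpos] at hlt
    apply Nat.le_floor
    push_cast
    linarith
  exact ⟨G, hG, E, hE.of_le hle, fun i => (hB i).of_le hle, fun v => (hS v).of_le hle,
    fun u v huv a => (hA u v huv a).of_le hle⟩

end Literature.Computability.MetaComplexity
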